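import Mathlib.RingTheory.MvPolynomial.Basic
import Mathlib.Algebra.MvPolynomial.Degrees
import Mathlib.Analysis.Complex.Basic
import Literature.Computability.AlgebraicComplexity.Elusive
import Literature.Computability.AlgebraicComplexity.RazElusive

/-!
# ValiantsHypothesis / Elusive — refutations

Problem `ValiantsHypothesis`, topic `Elusive` (Raz's elusive polynomial mappings, Theory of
Computing 6 (2010), Def. 1.1).

* `Summit.ValiantsHypothesis.Elusive.not_elusive_candidate` refutes
  `stmt-ValiantsHypothesis-0340` (`elusive_candidate`): the "Sidon moment curve"
  `x ↦ (x^{d_i})_{i<m}`, `d_i = (i+1)(2m²+1) + (i+1)²`, is NOT `(m-1, 2)`-elusive for any `m ≥ 7`.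
* `Summit.ValiantsHypothesis.Elusive.not_isElusive_momentCurve`: the same in the vocabulary of
  `Literature.Computability.AlgebraicComplexity.IsElusive` (Raz 2010, Def. 1.1), for the curve given by `X 0 ^ d_i ∈ ℂ[x]`.
* `Summit.ValiantsHypothesis.Elusive.raz_elusive_momentCurve_vacuous` settles
  `stmt-ValiantsHypothesis-0341` (`elusive_raz_candidate`, verbatim the named fact
  `Literature.Computability.AlgebraicComplexity.raz_elusive_momentCurve`) VACUOUSLY: its hypothesis is the refuted 0340.

## The swallowing family

For a monomial curve `x ↦ (x^{d_i})_{i<m}` take variables `t, (u_i)_{i ∈ S}` with `S` a set of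
`m - 2` coordinates and the ruled quadratic map `Γ_i = t·u_i (i ∈ S)`, `Γ_a = u_j u_k`,
`Γ_b = u_{j'} u_{k'}` for the two remaining coordinates `a, b`. Along the curve put `t = x^e`,
`u_i = x^{d_i - e}` (`x ≠ 0`, integer exponents of either sign); the last two coordinates match iff
`2e = d_j + d_k - d_a = d_{j'} + d_{k'} - d_b`, i.e. iff the exponents admit ONE six-term additive
coincidence `d_a + d_{j'} + d_{k'} = d_b + d_j + d_k`. A Sidon (`B₂`) condition does not exclude
this: with `v = i + 1`, `d = vN + v²` (`N = 2m² + 1`) and `{1, 5, 6}`, `{2, 3, 7}` have equal sums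
(12) and equal sums of squares (62), so `d_0 + d_4 + d_5 = d_1 + d_2 + d_6`, `2e = 18m² + 66`.
Hence for every `m ≥ 7` the curve lies in the image of
`Γ = (u_2 u_6, u_4 u_5, t u_2, t u_3, …, t u_{m-1}) : ℂ^{m-1} → ℂ^m` (at `x = 0` use `y = 0`);
`exists_quadratic_swallowing_momentCurve` records this.
Moral for the planner: monomial curves need at least a `B₃` exponent set against this family
(and `B_h` against its iterates); see the workitem note.
-/

namespace Summit.ValiantsHypothesis.Elusive

open MvPolynomial

/-- For every `m ≥ 7` an explicit quadratic map `ℂ^{m-1} → ℂ^m` whose image contains the Sidon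
moment curve: variable `0` is `t`, variable `j ≥ 1` is `u_{j+1}`; coordinates `0, 1` are
`u_2 u_6`, `u_4 u_5`, coordinate `i ≥ 2` is `t u_i`. [folklore] -/
theorem exists_quadratic_swallowing_momentCurve (m : ℕ) (hm : 7 ≤ m) :
    ∃ Γ : Fin m → MvPolynomial (Fin (m - 1)) ℂ, (∀ i, (Γ i).totalDegree ≤ 2) ∧
      Set.range (fun x : ℂ => fun i : Fin m =>
          x ^ (((i : ℕ) + 1) * (2 * m ^ 2 + 1) + ((i : ℕ) + 1) ^ 2)) ⊆
        Set.range (fun y : Fin (m - 1) → ℂ => fun i : Fin m => MvPolynomial.eval y (Γ i)) := by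
  refine ⟨fun i => if (i : ℕ) = 0 then X ⟨1, by omega⟩ * X ⟨5, by omega⟩
      else if (i : ℕ) = 1 then X ⟨3, by omega⟩ * X ⟨4, by omega⟩
      else X ⟨0, by omega⟩ * X ⟨(i : ℕ) - 1, by have := i.2; omega⟩, fun i => ?_, ?_⟩
  · dsimp only
    split_ifs <;>
      exact (totalDegree_mul _ _).trans (by rw [totalDegree_X, totalDegree_X])
  rintro _ ⟨x, rfl⟩
  by_cases hx : x = 0
  · subst hx
    refine ⟨fun _ => 0, funext fun i => ?_⟩
    dsimp only
    split_ifs <;> simp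
  · -- `t = x^e`, `u_{j+1} = x^{d_{j+1} - e}` with `e = 9m² + 33`.
    let e : ℤ := ((9 * m ^ 2 + 33 : ℕ) : ℤ)
    let y : Fin (m - 1) → ℂ := fun j =>
      if (j : ℕ) = 0 then x ^ e
      else x ^ (((((j : ℕ) + 2) * (2 * m ^ 2 + 1) + ((j : ℕ) + 2) ^ 2 : ℕ) : ℤ) - e)
    have key : ∀ (a b : ℤ) (n : ℕ), a + b = (n : ℤ) → x ^ a * x ^ b = x ^ n := by
      intro a b n h
      rw [← zpow_add₀ hx, h, zpow_natCast]
    refine ⟨y, funext fun i => ?_⟩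
    dsimp only
    split_ifs with h0 h1
    · simp only [map_mul, eval_X, y, if_neg (by decide : (1 : ℕ) ≠ 0),
        if_neg (by decide : (5 : ℕ) ≠ 0), h0]
      apply key
      simp only [e]
      push_cast
      ring
    · simp only [map_mul, eval_X, y, if_neg (by decide : (3 : ℕ) ≠ 0),
        if_neg (by decide : (4 : ℕ) ≠ 0), h1]
      apply key
      simp only [e]
      push_cast
      ring
    · have h2 : (i : ℕ) - 1 ≠ 0 := by omega
      have h1' : 1 ≤ (i : ℕ) := by omega
      simp only [map_mul, eval_X, y, if_neg h2]
      apply key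
      push_cast [Nat.cast_sub h1']
      ring

/-- Refutes stmt-ValiantsHypothesis-0340 (`elusive_candidate`): the Sidon moment curve
`x ↦ (x^{(i+1)(2m²+1)+(i+1)²})_{i<m}` is not `(m-1, 2)`-elusive for any `m ≥ 7` — it lies in the
image of the ruled quadratic map of `exists_quadratic_swallowing_momentCurve` (mechanism: one
six-term additive coincidence `d_0 + d_4 + d_5 = d_1 + d_2 + d_6` among the exponents, not
excluded by the Sidon property).
[folklore] -/
theorem not_elusive_candidate :
    ¬ (∃ m₀ : ℕ, ∀ m ≥ m₀, ∀ Γ : Fin m → MvPolynomial (Fin (m - 1)) ℂ,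
        (∀ i, (Γ i).totalDegree ≤ 2) →
          ¬ (Set.range (fun x : ℂ => fun i : Fin m =>
                x ^ (((i : ℕ) + 1) * (2 * m ^ 2 + 1) + ((i : ℕ) + 1) ^ 2)) ⊆
              Set.range (fun y : Fin (m - 1) → ℂ => fun i : Fin m => MvPolynomial.eval y (Γ i)))) := by
  rintro ⟨m₀, h⟩
  obtain ⟨Γ, hdeg, hsub⟩ := exists_quadratic_swallowing_momentCurve (m₀ + 7) (by omega)
  exact h (m₀ + 7) (by omega) Γ hdeg hsub

/-- The Sidon moment curve, as a tuple of one-variable polynomials `X 0 ^ d_i`, is not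
`(m-1, 2)`-elusive in the sense of `Literature.Computability.AlgebraicComplexity.IsElusive` (Raz 2010, Def. 1.1) once `m ≥ 7`.
[folklore] -/
theorem not_isElusive_momentCurve (m : ℕ) (hm : 7 ≤ m) :
    ¬ Literature.Computability.AlgebraicComplexity.IsElusive
        (fun i : Fin m => (X 0 : MvPolynomial (Fin 1) ℂ) ^
          (((i : ℕ) + 1) * (2 * m ^ 2 + 1) + ((i : ℕ) + 1) ^ 2)) (m - 1) 2 := by
  intro h
  obtain ⟨Γ, hdeg, hsub⟩ := exists_quadratic_swallowing_momentCurve m hm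
  refine h Γ hdeg ?_
  rintro _ ⟨y, rfl⟩
  obtain ⟨z, hz⟩ := hsub ⟨y 0, rfl⟩
  refine ⟨z, ?_⟩
  funext i
  have hi := congrFun hz i
  simp only [Literature.Computability.AlgebraicComplexity.polyMapEval_apply, map_pow, eval_X] at hi ⊢
  exact hi

/-- Settles stmt-ValiantsHypothesis-0341 (`elusive_raz_candidate`), i.e. the named fact
`Literature.Computability.AlgebraicComplexity.raz_elusive_momentCurve` (Raz's implication specialised to the Sidon moment curve),
VACUOUSLY: the hypothesis (eventual `(m-1,2)`-elusiveness of that curve) is refuted by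
`not_elusive_candidate`, so the implication carries no information about the permanent.
[folklore] -/
theorem raz_elusive_momentCurve_vacuous : Literature.Computability.AlgebraicComplexity.raz_elusive_momentCurve :=
  fun h => absurd h not_elusive_candidate

/-- Verbatim form of stmt-ValiantsHypothesis-0341 (the unfolded `raz_elusive_momentCurve`),
settled vacuously by `not_elusive_candidate`. [folklore] -/
theorem elusive_raz_candidate_vacuous :
    (∃ m₀ : ℕ, ∀ m ≥ m₀, ∀ Γ : Fin m → MvPolynomial (Fin (m - 1)) ℂ,
        (∀ i, (Γ i).totalDegree ≤ 2) →
          ¬ (Set.range (fun x : ℂ => fun i : Fin m =>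
                x ^ (((i : ℕ) + 1) * (2 * m ^ 2 + 1) + ((i : ℕ) + 1) ^ 2)) ⊆
              Set.range (fun y : Fin (m - 1) → ℂ => fun i : Fin m => MvPolynomial.eval y (Γ i)))) →
      ¬ Literature.Computability.AlgebraicComplexity.IsVPFamily (fun n => Literature.Computability.AlgebraicComplexity.perPoly (Fin n) ℂ) :=
  raz_elusive_momentCurve_vacuous

end Summit.ValiantsHypothesis.Elusive
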